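/-
Origin: expansion seat `prover-pub-hodgecm-mc-binder-2-g7-0`, handover #9 18:30Z md5 eb8f111daa70 (157 l.; imports #7 + twins `KonnoKonno2007/JunctionSmoothOneParameter` (PKG), `JunctionSwapSymmetry` (PKG), `JunctionVacuumExponents` (K-1 #K319) — INSTALL AFTER #7 and #K319; (J-plc)/(J-omg) at a real place v: `exists_vacExponents_cmBlockRepAt_κ_tensorPi` (∃ ONE junction vacuum character `e_v` with `ω′(s(κ k))(Φ₁ ⊠ Φ₂) = (κOp R' S' e_v k Φ₁) ⊠ Φ₂` for all k ∈ U(P')×U(Q')×U(R')×U(S'), Φ₁, Φ₂ — tree `exists_circle_twist_factorisation` + `IsArchWeilDatum.twist` + `RealDualPairJunction.exists_vacExponents` + `weilDatum_apply_κ_eq_κOp`), pinned differences `…_eR_sub_eS` (e_R − e_S = ∣P'∣ − ∣Q'∣ at W-indefinite places) / `…_eP_sub_eQ` (V-indefinite), native-frame `exists_vacExponents_cmArchWeilRep_κ`; farm amalgam rc 0 / 0 warn; axioms trio) (`HOME/mc/pub-hodgecm-mc-binder-2/g7/pkg/HodgeCM/Model/HypCensus/TorusBlock.lean`, md5 eb8f111d,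 157 lines);
landed by the gen-12 packager (p-g12) in gate run 36 as `HodgeCM/Model/HypCensus/TorusBlock.lean` (verbatim).
-/
/-
Origin: speedrun cell pub-hodgecm, MODEL-CONSTRUCTION sub-cell, lineage mc-binder-2 (rows A12/A34 of the binder ledger:
`hyp12` / `hyp34`), seat prover-pub-hodgecm-mc-binder-2-g7-0 (gen 7), 2026-08-19.  Target in PKG:
`HodgeCM/Model/HypCensus/TorusBlock.lean` (NEW additive leaf; imports this lineage's `SmoothTheta` and the K-1 twins of
`KonnoKonno2007/JunctionSmoothOneParameter`, `KonnoKonno2007/JunctionVacuumExponents`, `KonnoKonno2007/JunctionSwapSymmetry`).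
KERNEL only: 0 records / named facts / proof holes.
-/
import Summits.HodgeConjecture.HodgeCM.Model.HypCensus.SmoothTheta
import Literature.RepresentationTheory.KonnoKonno2007.JunctionSmoothOneParameter
import Literature.RepresentationTheory.KonnoKonno2007.JunctionVacuumExponents
import Literature.RepresentationTheory.KonnoKonno2007.JunctionSwapSymmetry

/-!
# Census kit (rows A12/A34), junctions (J-plc)/(J-omg) at a real place: the compact group `K_{V,v} × K_{W,v}` acts on the CM
# pin's Schwartz space by the EXPLICIT operators `κOp e_v k`, with place exponents `e_v` READ OFF the pin

The census field `ArchC.HypSmoothSide.omg_ins` (PKG `PerL34/ArchCHyperbolicSide.lean`; PerL v5 Lemma 4.1 ll. 472–487, setup D4/D5)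
asks that the archimedean torus act on the printed vectors by the printed scalings with PINNED vacuum characters.  The archimedean
content at one real place `v` is the action of Konno–Konno's maximal compact `K = U(P') × U(Q') × U(R') × U(S')` of the slot.  For the
(J-arch) datum of the CM pin read in the block frame of `v` (`ArchDatumBlockAt`) this leaf proves, by the same factorisation as
`SmoothBlock` ([Folland1989, Prop. (1.43), §4.2 (4.23)]) followed by theta-1's compact pin `RealDualPair.weilDatum_apply_κ_eq_κOp`
([Folland1989, Prop. (4.39)]) applied to the TWISTED small datum:

* §1 **`exists_vacExponents_cmBlockRepAt_κ_tensorPi`** — there is ONE exponent tuple `e_v : VacExponents` (depending on the pin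
  `hGR`, the place and the frames — NOT only on signatures: the factor character of the splitting enters) with
  `ω′ (s (κ k)) (Φ₁ ⊠ Φ₂) = (κOp e_v k Φ₁) ⊠ Φ₂` for ALL `k ∈ K`, `Φ₁`, `Φ₂`, where `κOp e k = vacScalar e k • unitaryOpPi (dualPairι k)`
  is the explicit Fock–Folland operator; and `e_v` is a `FockVacuumCharacter` exponent of the junction, so its DIFFERENCES are pinned
  by theta-1's zero-point theorems: **`eR_sub_eS_of_cmBlock`** `e_R − e_S = |P'| − |Q'|` when `W_v` is indefinite (`R'`, `S'` nonempty —
  the `Σ₁₂` places), **`eP_sub_eQ_of_cmBlock`** `e_P − e_Q = |R'| − |S'|` when `V_v` is indefinite (the place under `ι₁`).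
* §2 the native-frame form **`exists_vacExponents_cmArchWeilRep_κ`** (`ω_∞ (s (κ k)) (F⁻¹(Φ₁ ⊠ Φ₂)) = F⁻¹((κOp e_v k Φ₁) ⊠ Φ₂)`).

The absolute values of `e_v` are what the census READS OFF (`VacReadOff`, file of record LAST in the kit: `nVOf/nWOf`); this leaf is
the existence-and-pinned-differences half.  Nothing here is a claim of PerL/QW8.  Style lint (L-notation): no `local notation`.
-/

set_option autoImplicit false

noncomputable section

open Filter Topology
open NumberField NumberField.InfinitePlace IsDedekindDomain MeasureTheory
open scoped Matrix
open scoped Kronecker Classical TensorProduct ComplexConjugate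
open Literature.NumberTheory.Automorphic Literature.NumberTheory.Automorphic.UnitaryGroup Literature.NumberTheory.Weil1964
open Literature.RepresentationTheory.HeisenbergGroup (polar Heisenberg symplecticGroup ofSymplectic)
open Literature.RepresentationTheory.KonnoKonno2007 Literature.RepresentationTheory.KonnoKonno2007.RealDualPair
open Literature.NumberTheory.GelbartRogawski1991 Literature.NumberTheory.GelbartRogawski1991.UnitaryDualPair
open Literature.Analysis.SegalBargmann Literature.Analysis.Distribution

namespace HodgeCM.Model.HypCensus

section CMPinTorus

variable (L : Type) [Field L] [NumberField L] [IsCMField L] {N M n : ℕ} (e : Fin N × Fin M ≃ Fin n)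
variable (dV : Fin N → L) (hdV : ∀ i, IsCMField.complexConj L (dV i) = dV i) (hdV0 : ∀ i, dV i ≠ 0)
variable (dW : Fin M → L) (hdW : ∀ i, IsCMField.complexConj L (dW i) = dW i) (hdW0 : ∀ i, dW i ≠ 0)
variable (hGR : (cmSplittingDatum L e dV hdV hdV0 dW hdW hdW0).CompatibleSplitting) (ι₁ : L →+* ℂ)
variable (v : {v : InfinitePlace ↥(maximalRealSubfield L) // v.IsReal})
variable {P' Q' R' S' : Type} [Fintype P'] [DecidableEq P'] [Fintype Q'] [DecidableEq Q'] [Fintype R'] [DecidableEq R']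
  [Fintype S'] [DecidableEq S']
variable (eP : PosIdx (cmXV L dV hdV ι₁ v) ≃ P') (eQ : NegIdx (cmXV L dV hdV ι₁ v) ≃ Q')
  (eR : PosIdx (cmXW L dV dW hdW ι₁ v) ≃ R') (eS : NegIdx (cmXW L dV dW hdW ι₁ v) ≃ S')
variable
  (h₁V : ∃ i₀ : Fin N, (∀ i, i ≠ i₀ → 0 < (ι₁ (dV i)).re) ∨ ∀ i, i ≠ i₀ → (ι₁ (dV i)).re < 0)
  (h₁W : (∀ j, 0 < (ι₁ (dW j)).re) ∨ ∀ j, (ι₁ (dW j)).re < 0)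
  (hV : ∀ τ : L →+* ℂ, InfinitePlace.mk τ ≠ InfinitePlace.mk ι₁ →
    (∀ i, 0 < (τ (dV i)).re) ∨ ∀ i, (τ (dV i)).re < 0)
  (hW : ∀ τ : L →+* ℂ, InfinitePlace.mk τ ≠ InfinitePlace.mk ι₁ →
    (∃ j₀ : Fin M, ∀ j, j ≠ j₀ → 0 < (τ (dW j)).re) ∨ ∀ j, (τ (dW j)).re < 0)

/-! ## §1 The compact group of the slot acts by `κOp e_v`, with `e_v` a Fock vacuum character of the junction -/

include h₁V h₁W hV hW in
/-- **(J-plc)/(J-omg) at the place `v`.**  There is an exponent tuple `e_v`, a `FockVacuumCharacter` of Konno–Konno's junction of the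
slot, such that the (J-arch) datum of the CM pin acts on product vectors along `K_{V,v} × K_{W,v}` by `κOp e_v k` on the first factor:
`ω′ (s (κ k)) (Φ₁ ⊠ Φ₂) = (κOp e_v k Φ₁) ⊠ Φ₂` — for ANY small archimedean Weil datum `ω₁` of the slot (only its existence is used;
`e_v` is the vacuum exponent of the TWISTED small datum `χ ⊗ ω₁`, `χ` the factor character of the pin at `v`).
[Folland1989, Prop. (1.43), §4.2 (4.23), Prop. (4.39); KonnoKonno2007, Lemma 5.2 p. 73] -/
theorem exists_vacExponents_cmBlockRepAt_κ_tensorPi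
    {ω₁ : Representation ℂ (Ginf P' Q' R' S') (SchwartzMap (DPIdx P' Q' R' S' → ℝ) ℂ)}
    (hW₁ : IsArchWeilDatum (ι𝕎 P' Q' R' S') ω₁) (hc₁ : ∀ u, Continuous (ω₁ u)) :
    ∃ ev : VacExponents, (junction P' Q' R' S').FockVacuumCharacter ev ∧
      ∀ (k : DPK P' Q' R' S') (Φ₁ : SchwartzMap (DPIdx P' Q' R' S' → ℝ) ℂ)
        (Φ₂ : SchwartzMap (Fin n × {w : {w : InfinitePlace ↥(maximalRealSubfield L) // w.IsReal} // w ≠ v} → ℝ) ℂ),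
        cmBlockRepAt L e dV hdV hdV0 dW hdW hdW0 hGR ι₁ v eP eQ eR eS
            (cmBlockSectionAt L dV hdV hdV0 dW hdW hdW0 ι₁ v eP eQ eR eS (κ P' Q' R' S' k)) (tensorPi Φ₁ Φ₂) =
          tensorPi (κOp R' S' ev k Φ₁) Φ₂ := by
  obtain ⟨χ, hχ, hfac⟩ :=
    (isArchWeilDatum_cmBlockAt L e dV hdV hdV0 dW hdW hdW0 hGR ι₁ v eP eQ eR eS h₁V h₁W hV hW).exists_circle_twist_factorisation
      (continuous_cmBlockRepAt L e dV hdV hdV0 dW hdW hdW0 hGR ι₁ v eP eQ eR eS) hW₁ hc₁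
      (cmBlockSectionAt L dV hdV hdV0 dW hdW hdW0 ι₁ v eP eQ eR eS)
      (continuous_cmBlockSectionAt L dV hdV hdV0 dW hdW hdW0 ι₁ v eP eQ eR eS)
      (coe_cmBlockPhaseHomAt_cmBlockSectionAt L e dV hdV hdV0 dW hdW hdW0 ι₁ v eP eQ eR eS)
  have hW₁' : IsArchWeilDatum (junction P' Q' R' S').ι𝕎 (charTwist (Circle.coeHom.comp χ) ω₁) := hW₁.twist χ hχ
  obtain ⟨ev, hev⟩ := (junction P' Q' R' S').exists_vacExponents hW₁'
  refine ⟨ev, ⟨_, hW₁', hev⟩, fun k Φ₁ Φ₂ => ?_⟩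
  rw [hfac, weilDatum_apply_κ_eq_κOp hW₁' hev k Φ₁]

include h₁V h₁W hV hW in
/-- **The `W`-side difference is pinned** at a place where `W_v` is indefinite (`R'`, `S'` nonempty — the `Σ₁₂` places of PerL
Lemma 4.1): the exponent tuple of §1 satisfies `e_R − e_S = |P'| − |Q'|`, whatever the splitting `hGR`. [KonnoKonno2007, Lemma 5.2;
Folland1989, Prop. (4.39), Thm. (4.45)] -/
theorem exists_vacExponents_cmBlockRepAt_κ_tensorPi_eR_sub_eS
    {ω₁ : Representation ℂ (Ginf P' Q' R' S') (SchwartzMap (DPIdx P' Q' R' S' → ℝ) ℂ)}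
    (hW₁ : IsArchWeilDatum (ι𝕎 P' Q' R' S') ω₁) (hc₁ : ∀ u, Continuous (ω₁ u)) (r₀ : R') (s₀ : S') :
    ∃ ev : VacExponents, ev.eR - ev.eS = (Fintype.card P' : ℤ) - Fintype.card Q' ∧
      ∀ (k : DPK P' Q' R' S') (Φ₁ : SchwartzMap (DPIdx P' Q' R' S' → ℝ) ℂ)
        (Φ₂ : SchwartzMap (Fin n × {w : {w : InfinitePlace ↥(maximalRealSubfield L) // w.IsReal} // w ≠ v} → ℝ) ℂ),
        cmBlockRepAt L e dV hdV hdV0 dW hdW hdW0 hGR ι₁ v eP eQ eR eS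
            (cmBlockSectionAt L dV hdV hdV0 dW hdW hdW0 ι₁ v eP eQ eR eS (κ P' Q' R' S' k)) (tensorPi Φ₁ Φ₂) =
          tensorPi (κOp R' S' ev k Φ₁) Φ₂ := by
  obtain ⟨ev, hfv, h⟩ := exists_vacExponents_cmBlockRepAt_κ_tensorPi L e dV hdV hdV0 dW hdW hdW0 hGR ι₁ v eP eQ eR eS h₁V h₁W hV
    hW hW₁ hc₁
  exact ⟨ev, eR_sub_eS hfv r₀ s₀, h⟩

include h₁V h₁W hV hW in
/-- **The `V`-side difference is pinned** at a place where `V_v` is indefinite (`P'`, `Q'` nonempty — the place under `ι₁`):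
`e_P − e_Q = |R'| − |S'|`. [KonnoKonno2007, Lemma 5.2; Folland1989, Prop. (4.39), Thm. (4.45)] -/
theorem exists_vacExponents_cmBlockRepAt_κ_tensorPi_eP_sub_eQ
    {ω₁ : Representation ℂ (Ginf P' Q' R' S') (SchwartzMap (DPIdx P' Q' R' S' → ℝ) ℂ)}
    (hW₁ : IsArchWeilDatum (ι𝕎 P' Q' R' S') ω₁) (hc₁ : ∀ u, Continuous (ω₁ u)) (p₀ : P') (q₀ : Q') :
    ∃ ev : VacExponents, ev.eP - ev.eQ = (Fintype.card R' : ℤ) - Fintype.card S' ∧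
      ∀ (k : DPK P' Q' R' S') (Φ₁ : SchwartzMap (DPIdx P' Q' R' S' → ℝ) ℂ)
        (Φ₂ : SchwartzMap (Fin n × {w : {w : InfinitePlace ↥(maximalRealSubfield L) // w.IsReal} // w ≠ v} → ℝ) ℂ),
        cmBlockRepAt L e dV hdV hdV0 dW hdW hdW0 hGR ι₁ v eP eQ eR eS
            (cmBlockSectionAt L dV hdV hdV0 dW hdW hdW0 ι₁ v eP eQ eR eS (κ P' Q' R' S' k)) (tensorPi Φ₁ Φ₂) =
          tensorPi (κOp R' S' ev k Φ₁) Φ₂ := by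
  obtain ⟨ev, hfv, h⟩ := exists_vacExponents_cmBlockRepAt_κ_tensorPi L e dV hdV hdV0 dW hdW hdW0 hGR ι₁ v eP eQ eR eS h₁V h₁W hV
    hW hW₁ hc₁
  exact ⟨ev, eP_sub_eQ hfv p₀ q₀, h⟩

/-! ## §2 The native-frame form -/

include h₁V h₁W hV hW in
/-- **(J-omg) in the native frame**: `ω_∞ (s (κ k)) (F⁻¹(Φ₁ ⊠ Φ₂)) = F⁻¹((κOp e_v k Φ₁) ⊠ Φ₂)` for all `k`, `Φ₁`, `Φ₂`, with ONE
junction vacuum character `e_v`. [Folland1989, Prop. (1.43), Prop. (4.39)] -/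
theorem exists_vacExponents_cmArchWeilRep_κ
    {ω₁ : Representation ℂ (Ginf P' Q' R' S') (SchwartzMap (DPIdx P' Q' R' S' → ℝ) ℂ)}
    (hW₁ : IsArchWeilDatum (ι𝕎 P' Q' R' S') ω₁) (hc₁ : ∀ u, Continuous (ω₁ u)) :
    ∃ ev : VacExponents, (junction P' Q' R' S').FockVacuumCharacter ev ∧
      ∀ (k : DPK P' Q' R' S') (Φ₁ : SchwartzMap (DPIdx P' Q' R' S' → ℝ) ℂ)
        (Φ₂ : SchwartzMap (Fin n × {w : {w : InfinitePlace ↥(maximalRealSubfield L) // w.IsReal} // w ≠ v} → ℝ) ℂ),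
        cmArchWeilRep L e dV hdV hdV0 dW hdW hdW0 hGR
            (cmBlockSectionAt L dV hdV hdV0 dW hdW hdW0 ι₁ v eP eQ eR eS (κ P' Q' R' S' k))
            ((cmBlockFrameAt L e dV hdV hdV0 dW hdW hdW0 ι₁ v eP eQ eR eS).symm (tensorPi Φ₁ Φ₂)) =
          (cmBlockFrameAt L e dV hdV hdV0 dW hdW hdW0 ι₁ v eP eQ eR eS).symm (tensorPi (κOp R' S' ev k Φ₁) Φ₂) := by
  obtain ⟨ev, hfv, h⟩ := exists_vacExponents_cmBlockRepAt_κ_tensorPi L e dV hdV hdV0 dW hdW hdW0 hGR ι₁ v eP eQ eR eS h₁V h₁W hV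
    hW hW₁ hc₁
  refine ⟨ev, hfv, fun k Φ₁ Φ₂ => ?_⟩
  rw [cmArchWeilRep_eq_symm_cmBlockRepAt L e dV hdV hdV0 dW hdW hdW0 hGR ι₁ v eP eQ eR eS,
    ContinuousLinearEquiv.apply_symm_apply, h]

end CMPinTorus

end HodgeCM.Model.HypCensus

end
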